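/-
Copyright: cell pub-balaban-gaps (YM BLITZ Y1, track G1), seat g1-p2 GEN 8 (unit `pub-balaban-gaps-g1-p2`).  Row (D4) NODE O,
JUNCTION J-3 (multi-level) — ONE CONSTRUCTOR: from a BOND FIELD `U` on the fine torus of [4]'s nested family (fundamental representation,
inverses `U⁻¹`, a contour system `Γ`) in print's (3.37) window — `|U_μ(y) − 1| ≤ α₀L^{−lev y}`, `|U_μ(x) − U_μ(x − e_μ)| ≤ α₁L^{−2lev x}` (row
sums) — to Cor. 3.5's step for the Green function of the COVARIANT multi-level operator `Δ^U + Σ_j a_j(L^jη)^{−2}Q_j(U)*1_{Λ_j}Q_j(U)`: the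
defects `W⁺_μ = U_μ − 1`, `W⁻_μ = U_μ(· − e_μ)⁻¹ − 1` AND the covariant-averaging correction `Ã(U, Γ)` come from the SAME `U`, every window
is DERIVED (82's divergence identity, 81's contour window, 78a's neighbour levels), constants functions of `(d, ℓ, weight windows,
α₀, α₁)` — uniform in `k`, the torus, `{Ω_j}`, the fibre, `Γ`.  HONEST FRAMING: `U` is a hypothesis SHAPE (a bond field in the window,
NOT `e^{iηA}` produced from (3.35)–(3.36)); the flat operator is the lineage's scalar model ⊗ 1_F; invertibility of the perturbed
operator is not discharged here (76∕80's identities are conditional on it); (D4) NOT discharged (instance 0∕1); NOT BetaPertH, NOT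
continuum, NOT Clay.
-/
import Summits.QuantumFields.BalabanUV.Gaps.D4WalkBlockCovariantContourMultiLevel
import Summits.QuantumFields.BalabanUV.Gaps.D4WalkBlockBondFieldWeighted

/-!
# `Gaps.D4WalkBlockCovariantBondFieldMultiLevel` — Cor. 3.5's step for the covariant multi-level operator OF A BOND FIELD in the
# (3.37) window on [4]'s nested family: defects and covariant averaging from the same `U` (cell pub-balaban-gaps, seat g1-p2 gen 8)

HONEST DEPENDENCY (cell pub-balaban, verbatim): continuum YM on T⁴ ⇐ BetaPertH ∧ nine spine estimates (0/9 proved);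
BetaPertH ⇐ (D1) ∧ (D4) ∧ CAP+tail.

* §1 `eta_mul_levW` (`η·w(x) = L^{−lev x}`), **`inv_pow_lev_tshift_symm_le`** (`L^{−lev(x − e_μ)} ≤ L·L^{−lev x}` — torus neighbours'
  levels differ by ≤ 1, (2.2));
* §2 the windows of the expansion DERIVED from `U`'s: `window_at_tshift_symm`, **`bondWindow_fwd`** (`η(Lα₀)w`), **`bondWindow_bwd`**,
  **`bondWindow_div`** (`η²(d+1)(α₁ + (Lα₀)²)w²`, via 82's identity), **`contourBondWindow`** (contour bonds carry the block's level);
* §3 **`blockWalkExpansion_bondField_multiLevelTorus`** — for every admissible `(k, M_h, R, P, D, a, c, Kc)`, finite fibre, holomorphic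
  bond field `U_μ(u,y)` with inverses and the (3.37) windows (bond `α₀L^{−lev y}` at every site, derivative `α₁L^{−2lev x}`), contour
  system `Γ` inside the `lev`-blocks with `|Γ x| ≤ (d+1)L^{lev x}`, cube row sum `(μ, c_μ)`, `2μ ≤ ε`, `2μ ≤ δ₁ − ε − μ`, margin
  `c_μ(c_μ·1·(1·((0 + Σ_j covAlphaW (Lα₀) ((d+1)(α₁ + (Lα₀)²) + a₊(e^{2(d+1)α₀} − 1)) j·covBW δ₁ L j)C))c_μ)c_μ < 1`:
  `(W ⊗ 1)(1 − (V_W(U)(u) + Ã(U,Γ)(u)(w² ⊗ 1))(W ⊗ 1))⁻¹` is a block walk expansion at `(ε − 2μ, δ₁ − ε − 3μ, c_μC(1·(1−q)⁻¹)c_μ, δ₁ − 2μ)`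
  with the relative letters `covBW δ₁ L`, dominating distances (81's END fed with the windows DERIVED from `U`'s).
WHAT IT IS NOT.  `U = e^{iηA}` from (3.35)–(3.36) (D-O2-3a); the adjoint representation (74's `conjOp`) — here the fundamental one;
invertibility from letters (63); (D4) instance 0∕1; words of row (D4) UNCHANGED.

References: T. Bałaban, Comm. Math. Phys. **99** (1985) 389–434 [B9], (3.8) p. 392, (3.37) p. 396, (3.50)–(3.54) pp. 400–401,
(3.59)–(3.64) p. 402, (3.78) p. 406, Cor. 3.5 p. 407; Comm. Math. Phys. **96** (1984) [4], (2.2) p. 224, (2.13)–(2.14) p. 225.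
-/

noncomputable section

namespace Summit.QuantumFields.BalabanUV.Gaps.D4WalkBlockCovariantBondFieldMultiLevel

open Metric
open scoped Matrix
open Literature.MathematicalPhysics.QuantumFieldTheory.Balaban1983to89
open Literature.MathematicalPhysics.QuantumFieldTheory.Balaban1983to89.B4Reflection242 (boxDom blk)
open Literature.MathematicalPhysics.QuantumFieldTheory.Balaban1983to89.B9SectDWalk (DomBy)
open Literature.MathematicalPhysics.QuantumFieldTheory.Balaban1983to89.B9Thm34Ext (toB6)
open Literature.MathematicalPhysics.QuantumFieldTheory.Balaban1983to89.B9Thm37GlueTorus (torusGeom)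
open Literature.MathematicalPhysics.QuantumFieldTheory.Balaban1983to89.TreeLengthTorus (TPt)
open Literature.MathematicalPhysics.QuantumFieldTheory.Balaban1983to89.B5TorusCover (UT)
open Literature.MathematicalPhysics.QuantumFieldTheory.Balaban1983to89.B11SectG (RowSum)
open Literature.MathematicalPhysics.QuantumFieldTheory.Balaban1983to89.B4TorusKernel.MultiPeriod (torusSupNorm)
open Literature.MathematicalPhysics.QuantumFieldTheory.Balaban1983to89.B6MultiLevelBoxOperator (N0)
open Literature.MathematicalPhysics.QuantumFieldTheory.Balaban1983to89.B6MultiLevelTorusOperator (TDomains gmlT tshift unitVec one_le_N0)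
open Literature.MathematicalPhysics.QuantumFieldTheory.Balaban1983to89.B6Geom246MultiLevelTorus (torusSupNorm_neg)
open Literature.MathematicalPhysics.QuantumFieldTheory.Balaban1983to89.B6Ineq243TwoLevelBox (aNext)
open Summit.QuantumFields.BalabanUV.Gaps.D4WalkBlock (blockNorm BlockWalkExpansion)
open Summit.QuantumFields.BalabanUV.Gaps.D4WalkBlockMultiLevelGeometry (cubeML)
open Summit.QuantumFields.BalabanUV.Gaps.D4WalkBlockShiftAlgebra (covShift)
open Summit.QuantumFields.BalabanUV.Gaps.D4WalkBlockShiftWeighted (wOp covDopW covBW covAlphaW)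
open Summit.QuantumFields.BalabanUV.Gaps.D4WalkBlockShiftTransport (rowMass_sum_le')
open Summit.QuantumFields.BalabanUV.Gaps.D4WalkBlockWeightedLettersMultiLevel (levW lev_le_succ_of_near
  torusSupNorm_sub_tshift_symm_le_one)
open Summit.QuantumFields.BalabanUV.Gaps.D4WalkBlockCovariantAveragingMultiLevel (avCorr)
open Summit.QuantumFields.BalabanUV.Gaps.D4WalkBlockCovariantContourMultiLevel (contourT contourTi
  blockWalkExpansion_covAvgContour_multiLevelTorus)
open Summit.QuantumFields.BalabanUV.Gaps.D4WalkBlockBondFieldWeighted (rowSum_fwd_bwd_defect_le bondDefect_holo)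

variable {d : ℕ}

/-! ## §1. `η·w = L^{−lev}` and the neighbour bound -/

section Weight

variable {ℓ Mh k R : ℕ} {P : Fin (d + 1) → ℕ} {D : TDomains d ℓ Mh k P R}

/-- `η·w(x) = L^{−k}·L^{k − lev x} = L^{−lev x}`. -/
theorem eta_mul_levW (x : ↥(boxDom (N0 ℓ Mh k P))) :
    (((ℓ : ℝ) + 1) ^ k)⁻¹ * levW D x = ((((ℓ : ℝ) + 1) ^ D.lev x.1))⁻¹ := by
  have hL : ((ℓ : ℝ) + 1) ≠ 0 := by positivity
  unfold levW
  rw [pow_sub₀ _ hL (D.lev_le x.1)]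
  field_simp

/-- **`L^{−lev(σ_{e_μ}⁻¹x)} ≤ L·L^{−lev x}`** — torus neighbours' levels differ by at most one ((2.2), `R, M_h ≥ 1`).
[cite: Balaban1984PropagatorsII, (2.2) p.224] -/
theorem inv_pow_lev_tshift_symm_le (hR : 1 ≤ R) (hMh : 1 ≤ Mh) (hP : ∀ i, 1 ≤ P i) (μ : Fin (d + 1))
    (x : ↥(boxDom (N0 ℓ Mh k P))) :
    ((((ℓ : ℝ) + 1) ^ D.lev ((tshift (N0 ℓ Mh k P) (unitVec μ)).symm x).1))⁻¹ ≤
      ((ℓ : ℝ) + 1) * ((((ℓ : ℝ) + 1) ^ D.lev x.1))⁻¹ := by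
  have hL0 : (0 : ℝ) < (ℓ : ℝ) + 1 := by positivity
  have hL1 : (1 : ℝ) ≤ (ℓ : ℝ) + 1 := by linarith [(Nat.cast_nonneg ℓ : (0 : ℝ) ≤ ℓ)]
  have hsym : torusSupNorm (N0 ℓ Mh k P) (((tshift (N0 ℓ Mh k P) (unitVec μ)).symm x).1 - x.1) ≤ 1 := by
    rw [← neg_sub, torusSupNorm_neg (one_le_N0 hMh hP)]
    exact torusSupNorm_sub_tshift_symm_le_one μ x
  have hlev := lev_le_succ_of_near (D := D) hR hMh ((tshift (N0 ℓ Mh k P) (unitVec μ)).symm x) x hsym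
  calc ((((ℓ : ℝ) + 1) ^ D.lev ((tshift (N0 ℓ Mh k P) (unitVec μ)).symm x).1))⁻¹
      = ((ℓ : ℝ) + 1) * ((((ℓ : ℝ) + 1) ^ (D.lev ((tshift (N0 ℓ Mh k P) (unitVec μ)).symm x).1 + 1)))⁻¹ := by
        rw [pow_succ]; field_simp
    _ ≤ ((ℓ : ℝ) + 1) * ((((ℓ : ℝ) + 1) ^ D.lev x.1))⁻¹ :=
        mul_le_mul_of_nonneg_left (inv_anti₀ (by positivity) (pow_le_pow_right₀ hL1 hlev)) hL0.le

end Weight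

/-! ## §2. The windows of the expansion, DERIVED from the (3.37) windows of the bond field -/

section Windows

variable {ℓ Mh k R : ℕ} {P : Fin (d + 1) → ℕ} {D : TDomains d ℓ Mh k P R}
variable {F : Type} [Fintype F] [DecidableEq F] {E : Type*} [NormedAddCommGroup E] [NormedSpace ℂ E]
variable {U Ui : Fin (d + 1) → E → ↥(boxDom (N0 ℓ Mh k P)) → Matrix F F ℂ} {α₀ α₁ Rb : ℝ}

omit [DecidableEq F] [NormedSpace ℂ E] in
/-- a `t`-form window `M ≤ α₀L^{−lev y}` at the SHIFTED site `y = σ_{e_μ}⁻¹x` gives `≤ L^{−lev x}·(Lα₀)`. -/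
theorem window_at_tshift_symm (hR : 1 ≤ R) (hMh : 1 ≤ Mh) (hP : ∀ i, 1 ≤ P i) (hα₀ : 0 ≤ α₀)
    {M : Fin (d + 1) → E → ↥(boxDom (N0 ℓ Mh k P)) → Matrix F F ℂ}
    (hM : ∀ ν, ∀ u ∈ ball (0 : E) Rb, ∀ y a', ∑ b, ‖M ν u y a' b‖ ≤ α₀ * ((((ℓ : ℝ) + 1) ^ D.lev y.1))⁻¹) :
    ∀ ν, ∀ u ∈ ball (0 : E) Rb, ∀ x a',
      ∑ b, ‖M ν u ((tshift (N0 ℓ Mh k P) (unitVec ν)).symm x) a' b‖ ≤ ((((ℓ : ℝ) + 1) ^ D.lev x.1))⁻¹ * (((ℓ : ℝ) + 1) * α₀) := by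
  intro ν u hu x a'
  calc _ ≤ α₀ * ((((ℓ : ℝ) + 1) ^ D.lev ((tshift (N0 ℓ Mh k P) (unitVec ν)).symm x).1))⁻¹ := hM ν u hu _ a'
    _ ≤ α₀ * (((ℓ : ℝ) + 1) * ((((ℓ : ℝ) + 1) ^ D.lev x.1))⁻¹) :=
        mul_le_mul_of_nonneg_left (inv_pow_lev_tshift_symm_le (D := D) hR hMh hP ν x) hα₀
    _ = _ := by ring

omit [NormedSpace ℂ E] in
/-- **BOND WINDOW OF `W⁺ = U − 1`**: `α₀L^{−lev x} ≤ η·(Lα₀)·w(x)`. [cite: Balaban1985BackgroundPropagators, (3.37) p.396] -/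
theorem bondWindow_fwd (hα₀ : 0 ≤ α₀)
    (hU0 : ∀ ν, ∀ u ∈ ball (0 : E) Rb, ∀ y a', ∑ b, ‖(U ν u y - 1) a' b‖ ≤ α₀ * ((((ℓ : ℝ) + 1) ^ D.lev y.1))⁻¹) :
    ∀ ν, ∀ u ∈ ball (0 : E) Rb, ∀ x a',
      ∑ b, ‖(U ν u x - 1) a' b‖ ≤ (((ℓ : ℝ) + 1) ^ k)⁻¹ * (((ℓ : ℝ) + 1) * α₀) * levW D x := by
  intro ν u hu x a'
  have hL1 : (1 : ℝ) ≤ (ℓ : ℝ) + 1 := by linarith [(Nat.cast_nonneg ℓ : (0 : ℝ) ≤ ℓ)]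
  have ht0 : 0 ≤ ((((ℓ : ℝ) + 1) ^ D.lev x.1))⁻¹ := by positivity
  rw [mul_right_comm, eta_mul_levW x]
  calc _ ≤ α₀ * ((((ℓ : ℝ) + 1) ^ D.lev x.1))⁻¹ := hU0 ν u hu x a'
    _ ≤ _ := by rw [mul_comm]; exact mul_le_mul_of_nonneg_left (le_mul_of_one_le_left hα₀ hL1) ht0

omit [NormedSpace ℂ E] in
/-- **BOND WINDOW OF `W⁻ = U(· − e_μ)⁻¹ − 1`**: `α₀L^{−lev(x − e_μ)} ≤ η·(Lα₀)·w(x)` (neighbours' levels differ by ≤ 1).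
[cite: Balaban1985BackgroundPropagators, (3.37) p.396; Balaban1984PropagatorsII, (2.2) p.224] -/
theorem bondWindow_bwd (hR : 1 ≤ R) (hMh : 1 ≤ Mh) (hP : ∀ i, 1 ≤ P i) (hα₀ : 0 ≤ α₀)
    (hUi0 : ∀ ν, ∀ u ∈ ball (0 : E) Rb, ∀ y a', ∑ b, ‖(Ui ν u y - 1) a' b‖ ≤ α₀ * ((((ℓ : ℝ) + 1) ^ D.lev y.1))⁻¹) :
    ∀ ν, ∀ u ∈ ball (0 : E) Rb, ∀ x a',
      ∑ b, ‖(Ui ν u ((tshift (N0 ℓ Mh k P) (unitVec ν)).symm x) - 1) a' b‖ ≤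
        (((ℓ : ℝ) + 1) ^ k)⁻¹ * (((ℓ : ℝ) + 1) * α₀) * levW D x := by
  intro ν u hu x a'
  rw [mul_right_comm, eta_mul_levW x]
  exact window_at_tshift_symm (M := fun ν u y => Ui ν u y - 1) hR hMh hP hα₀ hUi0 ν u hu x a'

omit [NormedSpace ℂ E] in
/-- **DIVERGENCE WINDOW** `Σ_μ(W⁺_μ + W⁻_μ)`: from the derivative window `α₁L^{−2lev x}`, the bond windows and `U·U⁻¹ = 1` (82's
identity): `≤ η²·(d+1)(α₁ + (Lα₀)²)·w(x)²`. [cite: Balaban1985BackgroundPropagators, (3.37) p.396, (3.54) p.401] -/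
theorem bondWindow_div (hR : 1 ≤ R) (hMh : 1 ≤ Mh) (hP : ∀ i, 1 ≤ P i) (hα₀ : 0 ≤ α₀) (hinv : ∀ ν u y, U ν u y * Ui ν u y = 1)
    (hU0 : ∀ ν, ∀ u ∈ ball (0 : E) Rb, ∀ y a', ∑ b, ‖(U ν u y - 1) a' b‖ ≤ α₀ * ((((ℓ : ℝ) + 1) ^ D.lev y.1))⁻¹)
    (hUi0 : ∀ ν, ∀ u ∈ ball (0 : E) Rb, ∀ y a', ∑ b, ‖(Ui ν u y - 1) a' b‖ ≤ α₀ * ((((ℓ : ℝ) + 1) ^ D.lev y.1))⁻¹)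
    (hU1 : ∀ ν, ∀ u ∈ ball (0 : E) Rb, ∀ x a', ∑ b, ‖(U ν u x - U ν u ((tshift (N0 ℓ Mh k P) (unitVec ν)).symm x)) a' b‖ ≤
      α₁ * ((((ℓ : ℝ) + 1) ^ D.lev x.1))⁻¹ ^ 2) :
    ∀ u ∈ ball (0 : E) Rb, ∀ x a',
      ∑ b, ‖(∑ ν, ((U ν u x - 1) + (Ui ν u ((tshift (N0 ℓ Mh k P) (unitVec ν)).symm x) - 1))) a' b‖ ≤
        ((((ℓ : ℝ) + 1) ^ k)⁻¹) ^ 2 * (((d : ℝ) + 1) * (α₁ + (((ℓ : ℝ) + 1) * α₀) ^ 2)) * levW D x ^ 2 := by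
  intro u hu x a'
  have hb1 := window_at_tshift_symm (M := fun ν u y => U ν u y - 1) hR hMh hP hα₀ hU0
  have hb2 := window_at_tshift_symm (M := fun ν u y => Ui ν u y - 1) hR hMh hP hα₀ hUi0
  calc _ ≤ ∑ ν, ∑ b, ‖((U ν u x - 1) + (Ui ν u ((tshift (N0 ℓ Mh k P) (unitVec ν)).symm x) - 1)) a' b‖ :=
        rowMass_sum_le' _ _ _
    _ ≤ ∑ _ν : Fin (d + 1), (α₁ * ((((ℓ : ℝ) + 1) ^ D.lev x.1))⁻¹ ^ 2 +
          (((((ℓ : ℝ) + 1) ^ D.lev x.1))⁻¹ * (((ℓ : ℝ) + 1) * α₀)) * (((((ℓ : ℝ) + 1) ^ D.lev x.1))⁻¹ * (((ℓ : ℝ) + 1) * α₀))) :=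
        Finset.sum_le_sum fun ν _ => rowSum_fwd_bwd_defect_le _ _ _ (hinv ν u _) (by positivity) (hU1 ν u hu x) (hb1 ν u hu x)
          (hb2 ν u hu x) a'
    _ = (((d : ℝ) + 1) * (α₁ + (((ℓ : ℝ) + 1) * α₀) ^ 2)) * ((((ℓ : ℝ) + 1) ^ k)⁻¹ * levW D x) ^ 2 := by
        rw [eta_mul_levW x, Finset.sum_const, Finset.card_univ, Fintype.card_fin, nsmul_eq_mul]; push_cast; ring
    _ = ((((ℓ : ℝ) + 1) ^ k)⁻¹) ^ 2 * (((d : ℝ) + 1) * (α₁ + (((ℓ : ℝ) + 1) * α₀) ^ 2)) * levW D x ^ 2 := by ring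

omit [Fintype F] [DecidableEq F] [NormedSpace ℂ E] in
/-- **THE CONTOUR BONDS CARRY THE WINDOW OF THE BLOCK'S LEVEL** (contours inside the `lev`-blocks, levels constant on blocks). -/
theorem contourBondWindow [Fintype F] [DecidableEq F] {Γ : ↥(boxDom (N0 ℓ Mh k P)) → List (↥(boxDom (N0 ℓ Mh k P)) × Fin (d + 1))}
    {M : Fin (d + 1) → E → ↥(boxDom (N0 ℓ Mh k P)) → Matrix F F ℂ}
    (hblkΓ : ∀ x, ∀ b ∈ Γ x, blk ((ℓ + 1) ^ D.lev x.1) b.1.1 = blk ((ℓ + 1) ^ D.lev x.1) x.1)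
    (hM : ∀ ν, ∀ u ∈ ball (0 : E) Rb, ∀ y a', ∑ b, ‖(M ν u y - 1) a' b‖ ≤ α₀ * ((((ℓ : ℝ) + 1) ^ D.lev y.1))⁻¹) :
    ∀ u ∈ ball (0 : E) Rb, ∀ x : ↥(boxDom (N0 ℓ Mh k P)), ∀ b ∈ Γ x, ∀ c',
      ∑ b', ‖((fun u (b : ↥(boxDom (N0 ℓ Mh k P)) × Fin (d + 1)) => M b.2 u b.1) u b - 1) c' b'‖ ≤
        ((((ℓ : ℝ) + 1) ^ D.lev x.1)⁻¹) * α₀ := by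
  intro u hu x b hb c'
  have hlev : D.lev b.1.1 = D.lev x.1 := D.lev_eq_of_blk_eq x.2 b.1.2 (hblkΓ x b hb)
  rw [mul_comm, ← hlev]
  exact hM b.2 u hu b.1 c'

end Windows

/-! ## §3. Cor. 3.5's step for the covariant multi-level operator of a bond field -/

section Step

variable {dd N' : ℕ} {E : Type*} [NormedAddCommGroup E] [NormedSpace ℂ E]

/-- **[B9] COR. 3.5's STEP FOR THE COVARIANT MULTI-LEVEL OPERATOR OF A BOND FIELD IN THE (3.37) WINDOW, ON THE GENUINE NESTED FAMILY.**
There are `δ₁, C, M₀ > 0`, `N₀ ≥ 1` (functions of `d, ℓ`, weight windows) such that for every admissible `(k, M_h, R, P, D, a, c, Kc)`, every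
finite fibre, every holomorphic bond field `U_μ(u,y)` (forward transporters, fundamental representation) with holomorphic inverses
`U_μ(u,y)⁻¹` and the (3.37) WINDOWS — `Σ_b‖(U_μ(u,y)^{±1} − 1)_{ab}‖ ≤ α₀L^{−lev y}` at every site, `Σ_b‖(U_μ(u,x) − U_μ(u,x − e_μ))_{ab}‖ ≤
α₁L^{−2lev x}` — every contour system `Γ` inside the `lev`-blocks with `|Γ x| ≤ (d+1)L^{lev x}`, every cube row sum `(μ, c_μ)`, `2μ ≤ ε`,
`2μ ≤ δ₁ − ε − μ`, margin `c_μ(c_μ·1·(1·((0 + Σ_j covAlphaW (Lα₀) ((d+1)(α₁ + (Lα₀)²) + a₊(e^{2(d+1)α₀} − 1)) j·covBW δ₁ L j)C))c_μ)c_μ < 1`: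
with `W⁺_μ = U_μ − 1`, `W⁻_μ = U_μ(· − e_μ)⁻¹ − 1`, `T = Π_{Γ}U`, `T̃ = Πʳ_{Γ}U⁻¹`:
`(W ⊗ 1)(1 − (V_W(u) + Ã(u)(w² ⊗ 1))(W ⊗ 1))⁻¹` is a block walk expansion at `(ε − 2μ, δ₁ − ε − 3μ, c_μC(1·(1−q)⁻¹)c_μ, δ₁ − 2μ)` with the
relative letters `covBW δ₁ L`, dominating distances — it expands `(Δ_W + L^{2k}covAvgOp)⁻¹` (80's identity), the covariant operator of `U`.
[cite: Balaban1985BackgroundPropagators, Cor. 3.5 p.407, (3.8) p.392, (3.37) p.396, (3.50)–(3.54) pp.400–401, (3.59)–(3.61) p.402, (3.78) p.406; Balaban1984PropagatorsII, (2.2) p.224, (2.13)–(2.14) p.225; Balaban1988RG2Cluster, (1.11) p.5] -/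
theorem blockWalkExpansion_bondField_multiLevelTorus (d ℓ : ℕ) (hℓ : 1 ≤ ℓ) (aminus aplus a2minus a2plus : ℝ)
    (ha : 0 < aminus) (ha2 : 0 < a2minus) :
    ∃ δ₁ C M₀ : ℝ, ∃ N₀ : ℕ, 0 < δ₁ ∧ 0 < C ∧ 0 < M₀ ∧ 0 < N₀ ∧
      ∀ (k Mh R : ℕ), 3 ≤ Mh → M₀ ≤ ((ℓ : ℝ) + 1) * Mh → 2 * (ℓ + 1) ≤ R → N₀ + 1 ≤ R * ((ℓ + 1) * Mh) →
      ∀ (P : Fin (d + 1) → ℕ) (hP : ∀ μ, 1 ≤ P μ) (hP4 : ∀ μ, 4 ≤ P μ) (D : TDomains d ℓ Mh k P R) (a c : ℕ → ℝ),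
        (∀ i, 1 ≤ i → aminus ≤ a i ∧ a i ≤ aplus) → (∀ i, 1 ≤ i → a2minus ≤ c i ∧ c i ≤ a2plus) →
        (∀ i, 1 ≤ i → a (i + 1) = aNext ℓ (a i) (c i)) →
      ∀ (Kc : Fin (d + 1) → ℕ) [∀ i, NeZero (Kc i)], (∀ i, N0 ℓ Mh k P i = (ℓ + 1) ^ k * Kc i) →
      ∀ (F : Type) [Fintype F] [DecidableEq F] (c₀ : B13.Consts) (Xs : Finset (UT Kc)) (Rb : ℝ)
        (U Ui : Fin (d + 1) → E → ↥(boxDom (N0 ℓ Mh k P)) → Matrix F F ℂ)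
        (Γ : ↥(boxDom (N0 ℓ Mh k P)) → List (↥(boxDom (N0 ℓ Mh k P)) × Fin (d + 1))) (α₀ α₁ ε μ cμ : ℝ),
      (∀ ν y a' b, DifferentiableOn ℂ (fun u => U ν u y a' b) (ball (0 : E) Rb)) →
      (∀ ν y a' b, DifferentiableOn ℂ (fun u => Ui ν u y a' b) (ball (0 : E) Rb)) →
      (∀ ν u y, U ν u y * Ui ν u y = 1) → 0 ≤ α₀ → 0 ≤ α₁ →
      (∀ ν, ∀ u ∈ ball (0 : E) Rb, ∀ y a', ∑ b, ‖(U ν u y - 1) a' b‖ ≤ α₀ * ((((ℓ : ℝ) + 1) ^ D.lev y.1))⁻¹) →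
      (∀ ν, ∀ u ∈ ball (0 : E) Rb, ∀ y a', ∑ b, ‖(Ui ν u y - 1) a' b‖ ≤ α₀ * ((((ℓ : ℝ) + 1) ^ D.lev y.1))⁻¹) →
      (∀ ν, ∀ u ∈ ball (0 : E) Rb, ∀ x a', ∑ b, ‖(U ν u x - U ν u ((tshift (N0 ℓ Mh k P) (unitVec ν)).symm x)) a' b‖ ≤
        α₁ * ((((ℓ : ℝ) + 1) ^ D.lev x.1))⁻¹ ^ 2) →
      (∀ x, (Γ x).length ≤ (d + 1) * (ℓ + 1) ^ D.lev x.1) →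
      (∀ x, ∀ b ∈ Γ x, blk ((ℓ + 1) ^ D.lev x.1) b.1.1 = blk ((ℓ + 1) ^ D.lev x.1) x.1) →
      0 ≤ μ → 2 * μ ≤ ε → 2 * μ ≤ δ₁ - ε - μ → 0 ≤ cμ →
      RowSum (toB6 (torusGeom Kc 0 0 0) 0 True) μ cμ →
      cμ * (cμ * 1 * (1 * ((0 + ∑ j : Unit ⊕ (Fin (d + 1) ⊕ Fin (d + 1)),
        covAlphaW (((ℓ : ℝ) + 1) * α₀) (((d : ℝ) + 1) * (α₁ + (((ℓ : ℝ) + 1) * α₀) ^ 2) +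
          aplus * (Real.exp (2 * ((d : ℝ) + 1) * α₀) - 1)) j * covBW δ₁ ((ℓ : ℝ) + 1) j) * C)) * cμ) * cμ < 1 →
      ∃ (W : Type) (T : W → (TPt dd N' → ℂ) → E → Matrix (↥(boxDom (N0 ℓ Mh k P)) × F) (↥(boxDom (N0 ℓ Mh k P)) × F) ℂ)
        (SX' : Set W) (A' : W → ℝ) (D' : W → UT Kc → UT Kc → ℝ),
        BlockWalkExpansion c₀ (fun q : ↥(boxDom (N0 ℓ Mh k P)) × F => cubeML ℓ k Kc q.1.1)
          (fun q : ↥(boxDom (N0 ℓ Mh k P)) × F => cubeML ℓ k Kc q.1.1)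
          (fun (_ : TPt dd N' → ℂ) u =>
            Matrix.blockDiagonal (fun _ : F =>
                ((((ℓ : ℂ) + 1) ^ (2 * k))⁻¹ : ℂ) • (gmlT (N0 ℓ Mh k P) ℓ k D.lev a).map ((↑) : ℝ → ℂ)) *
              (1 - (covShift ↥(boxDom (N0 ℓ Mh k P)) F (fun ν => tshift (N0 ℓ Mh k P) (unitVec ν)) ((((ℓ : ℝ) + 1) ^ k)⁻¹)
                    (fun ν u x => U ν u x - 1) (fun ν u x => Ui ν u ((tshift (N0 ℓ Mh k P) (unitVec ν)).symm x) - 1) u +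
                  avCorr D a (contourT Γ fun u b => U b.2 u b.1) (contourTi Γ fun u b => Ui b.2 u b.1) u *
                    wOp ↥(boxDom (N0 ℓ Mh k P)) F (fun x => levW D x ^ 2)) *
                Matrix.blockDiagonal (fun _ : F =>
                  ((((ℓ : ℂ) + 1) ^ (2 * k))⁻¹ : ℂ) • (gmlT (N0 ℓ Mh k P) ℓ k D.lev a).map ((↑) : ℝ → ℂ)))⁻¹)
          Xs Rb (ε - 2 * μ) (δ₁ - ε - μ - 2 * μ)
          (cμ * C * (1 * (1 - cμ * (cμ * 1 * (1 * ((0 + ∑ j : Unit ⊕ (Fin (d + 1) ⊕ Fin (d + 1)),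
            covAlphaW (((ℓ : ℝ) + 1) * α₀) (((d : ℝ) + 1) * (α₁ + (((ℓ : ℝ) + 1) * α₀) ^ 2) +
              aplus * (Real.exp (2 * ((d : ℝ) + 1) * α₀) - 1)) j * covBW δ₁ ((ℓ : ℝ) + 1) j) * C)) * cμ) * cμ)⁻¹) * cμ)
          T SX' A' D' (δ₁ - 2 * μ) ∧
        (∀ (j : Unit ⊕ (Fin (d + 1) ⊕ Fin (d + 1))) ω (σ : TPt dd N' → ℂ), (∀ i, ‖σ i‖ ≤ Real.exp c₀.κ₁) →
          ∀ u ∈ ball (0 : E) Rb, ∀ Y Y',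
          blockNorm (fun q : ↥(boxDom (N0 ℓ Mh k P)) × F => cubeML ℓ k Kc q.1.1)
              (fun q : ↥(boxDom (N0 ℓ Mh k P)) × F => cubeML ℓ k Kc q.1.1)
              (covDopW ↥(boxDom (N0 ℓ Mh k P)) F (fun ν => tshift (N0 ℓ Mh k P) (unitVec ν)) ((((ℓ : ℝ) + 1) ^ k)⁻¹) (levW D) j *
                T ω σ u) Y Y' ≤
            covBW (ι := Fin (d + 1)) δ₁ ((ℓ : ℝ) + 1) j * (A' ω * Real.exp (-((δ₁ - 2 * μ) * D' ω Y Y')))) ∧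
        ∀ ω, DomBy (toB6 (torusGeom Kc 0 0 0) 0 True) (D' ω) := by
  obtain ⟨δ₁, C, M₀, N₀, hδ₁, hC, hM₀, hN₀, hmain⟩ :=
    blockWalkExpansion_covAvgContour_multiLevelTorus (dd := dd) (N' := N') (E := E) d ℓ hℓ aminus aplus a2minus a2plus ha ha2
  refine ⟨δ₁, C, M₀, N₀, hδ₁, hC, hM₀, hN₀, ?_⟩
  intro k Mh R hMh hM hR hRM P hP hP4 D a c haw hcw hac Kc _ hKc F _ _ c₀ Xs Rb U Ui Γ α₀ α₁ ε μ cμ hUh hUih hinv hα₀ hα₁ hU0 hUi0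
    hU1 hlen hblkΓ hμ hμε hμκ hcμ hrow hq
  have hMh1 : 1 ≤ Mh := le_trans (by norm_num) hMh
  have hR1 : 1 ≤ R := le_trans (by omega) hR
  have hαT : 0 ≤ Real.exp (2 * ((d : ℝ) + 1) * α₀) - 1 := by
    have : (1 : ℝ) ≤ Real.exp (2 * ((d : ℝ) + 1) * α₀) := Real.one_le_exp (by positivity)
    linarith
  exact hmain k Mh R hMh hM hR hRM P hP hP4 D a c haw hcw hac Kc hKc F c₀ Xs Rb (fun ν u x => U ν u x - 1)
    (fun ν u x => Ui ν u ((tshift (N0 ℓ Mh k P) (unitVec ν)).symm x) - 1) (↥(boxDom (N0 ℓ Mh k P)) × Fin (d + 1)) Γ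
    (fun u b => U b.2 u b.1) (fun u b => Ui b.2 u b.1)
    (((ℓ : ℝ) + 1) * α₀) (((d : ℝ) + 1) * (α₁ + (((ℓ : ℝ) + 1) * α₀) ^ 2)) α₀ ε μ cμ
    (fun ν x a' b => bondDefect_holo (U := fun u => U ν u x) (hUh ν x) a' b)
    (fun ν x a' b => bondDefect_holo (U := fun u => Ui ν u ((tshift (N0 ℓ Mh k P) (unitVec ν)).symm x)) (hUih ν _) a' b)
    (fun b c c' => hUh b.2 b.1 c c') (fun b c c' => hUih b.2 b.1 c c') (by positivity) (by positivity) hα₀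
    (bondWindow_fwd (D := D) hα₀ hU0) (bondWindow_bwd (D := D) hR1 hMh1 hP hα₀ hUi0)
    (bondWindow_div (D := D) hR1 hMh1 hP hα₀ hinv hU0 hUi0 hU1) hlen (contourBondWindow (D := D) hblkΓ hU0)
    (contourBondWindow (D := D) hblkΓ hUi0) hμ hμε hμκ hcμ hrow hq

end Step

/-! ## §6. (v1.2) Level-weight bookkeeping for the covariant letters: `ηw ≤ 1`, the BACKWARD ratio, windows in weighted form -/

section WeightCov

variable {ℓ Mh k R : ℕ} {P : Fin (d + 1) → ℕ} (D : TDomains d ℓ Mh k P R)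

/-- `η·w(x) = L^{−lev x} ≤ 1`. -/
theorem eta_mul_levW_le_one (x : ↥(boxDom (N0 ℓ Mh k P))) : (((ℓ : ℝ) + 1) ^ k)⁻¹ * levW D x ≤ 1 := by
  rw [eta_mul_levW (D := D) x]
  exact inv_le_one_of_one_le₀ (one_le_pow₀ (by linarith [(Nat.cast_nonneg ℓ : (0 : ℝ) ≤ ℓ)]))

variable {D} in
/-- **backward neighbour ratio**: `w(x − e_μ) ≤ L·w(x)` (torus neighbours' levels differ by ≤ 1, (2.2) with `R, M_h ≥ 1`; the forward
ratio `w(x) ≤ L·w(x − e_μ)` is 78a's `levW_le_mul_tshift_symm`). [cite: Balaban1984PropagatorsII, (2.2) p.224] -/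
theorem levW_tshift_symm_le_mul (hR : 1 ≤ R) (hMh : 1 ≤ Mh) (μ : Fin (d + 1)) (x : ↥(boxDom (N0 ℓ Mh k P))) :
    levW D ((tshift (N0 ℓ Mh k P) (unitVec μ)).symm x) ≤ ((ℓ : ℝ) + 1) * levW D x := by
  have hL1 : (1 : ℝ) ≤ (ℓ : ℝ) + 1 := by linarith [(Nat.cast_nonneg ℓ : (0 : ℝ) ≤ ℓ)]
  have hN : ∀ i, 1 ≤ N0 ℓ Mh k P i := B6MultiLevelTorusOperator.one_le_of_mem x.2
  have hn : torusSupNorm (N0 ℓ Mh k P) (((tshift (N0 ℓ Mh k P) (unitVec μ)).symm x).1 - x.1) ≤ 1 := by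
    rw [← neg_sub, torusSupNorm_neg hN]
    exact torusSupNorm_sub_tshift_symm_le_one μ x
  have hlev := lev_le_succ_of_near (D := D) hR hMh ((tshift (N0 ℓ Mh k P) (unitVec μ)).symm x) x hn
  unfold levW
  rw [← pow_succ']
  exact pow_le_pow_right₀ hL1 (by omega)

/-- the level window in weighted form: `α₀L^{−lev y} = η·α₀·w(y)`. -/
theorem window_weighted (α₀ : ℝ) (y : ↥(boxDom (N0 ℓ Mh k P))) :
    α₀ * ((((ℓ : ℝ) + 1) ^ D.lev y.1))⁻¹ = (((ℓ : ℝ) + 1) ^ k)⁻¹ * α₀ * levW D y := by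
  rw [← eta_mul_levW (D := D) y]; ring

/-- a fibre row window `α₀L^{−lev y}` in the weighted form `η·(Lα₀)·w(y)` (the shape `D4WalkBlockCovariantDerivative`'s letters take). -/
theorem weighted_window_of_lev {F : Type} [Fintype F] {α₀ : ℝ} (hα₀ : 0 ≤ α₀) {M : Matrix F F ℂ} {a' : F}
    (y : ↥(boxDom (N0 ℓ Mh k P))) (h : ∑ b, ‖M a' b‖ ≤ α₀ * ((((ℓ : ℝ) + 1) ^ D.lev y.1))⁻¹) :
    ∑ b, ‖M a' b‖ ≤ (((ℓ : ℝ) + 1) ^ k)⁻¹ * (((ℓ : ℝ) + 1) * α₀) * levW D y := by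
  refine h.trans ?_
  rw [window_weighted D α₀ y]
  have := D4WalkBlockWeightedLettersMultiLevel.levW_pos (D := D) y
  have hη : (0 : ℝ) ≤ (((ℓ : ℝ) + 1) ^ k)⁻¹ := by positivity
  nlinarith [mul_nonneg (mul_nonneg hη hα₀) this.le]

/-- `1 ≤ w(x) = L^{k − lev x}` (`lev ≤ k`): the level weight never drops below the top-scale value. -/
theorem one_le_levW (x : ↥(boxDom (N0 ℓ Mh k P))) : 1 ≤ levW D x :=
  one_le_pow₀ (by linarith [(Nat.cast_nonneg ℓ : (0 : ℝ) ≤ ℓ)])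

/-- `w(x) ≤ L^{k−1} ≤ η⁻¹` (`1 ≤ lev`): the level weight is at most the top inverse scale over `L`. [cite: Balaban1984PropagatorsII, (2.1) p.224] -/
theorem levW_le_pow (x : ↥(boxDom (N0 ℓ Mh k P))) : levW D x ≤ ((ℓ : ℝ) + 1) ^ (k - 1) := by
  unfold levW
  exact pow_le_pow_right₀ (by linarith [(Nat.cast_nonneg ℓ : (0 : ℝ) ≤ ℓ)]) (by have := D.one_le_lev x.1; omega)

/-- the sharp forward form: a fibre row window `α₀L^{−lev y}` IS `η·α₀·w(y)` (no factor `L`). -/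
theorem weighted_window_of_lev_sharp {F : Type} [Fintype F] {α₀ : ℝ} {M : Matrix F F ℂ} {a' : F}
    (y : ↥(boxDom (N0 ℓ Mh k P))) (h : ∑ b, ‖M a' b‖ ≤ α₀ * ((((ℓ : ℝ) + 1) ^ D.lev y.1))⁻¹) :
    ∑ b, ‖M a' b‖ ≤ (((ℓ : ℝ) + 1) ^ k)⁻¹ * α₀ * levW D y := by
  rw [← window_weighted D α₀ y]; exact h

end WeightCov

end Summit.QuantumFields.BalabanUV.Gaps.D4WalkBlockCovariantBondFieldMultiLevel

end
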